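import Summits.BirchSwinnertonDyer.BirchSwinnertonDyer.Theorems.RamifiedSevenEllipticUnitsStrictTorsionOfGZK
import HarnessLib

set_option linter.dupNamespace false
set_option autoImplicit false

/-!
# Route `RamifiedSevenEllipticUnits` (rung K7r), crux `StrictTorsionSeven` (stmt-BirchSwinnertonDyer-19144):
# the typed object (R-tors) `X12.O11.RamifiedCMStrictTorsionAt W p` at EVERY CM-ramified prime `p`,
# from Gross–Zagier–Kolyvagin and the two local no-`p`-torsion inputs

Cell `bsd-cm`, seat `bsd-cm-k7r-c3` (g4). HONEST FRAMING: nothing here closes crux #3 and BSD is not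
proved by any of this; a closed item closes a rung leaf of BirchSwinnertonDyer at most. This is
frame-level content of the crux's typed object BEYOND the class 𝒞₇ / the prime `7`: the O11 corner
(CM, analytic rank one, `p = |d_K|` ramified in the CM field) has census cells at every
`p ∈ {7, 11, 19, 43, 67, 163}`, and the K7r kernel chain for (R-tors) is `p`-generic except for its
two LOCAL inputs.

## What is proved (every prime `p`; an O11 frame forces `p ≥ 5`)

* (D♮)_p `natCard_selmerAcBase_frame_eq_mul_prime` — at every O11 frame `(K, 𝔭, W', C)` of `(W, p)`:
  `#Sel_𝔭(K, E[p^∞]) = #Sel_str(E/ℚ)[p^∞] · #Sel_str(E'/ℚ)[p^∞]` in `Nat.card` (no finiteness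
  hypothesis): Castella bridge (`𝔭` is the unique prime above the ramified `p`, `K` totally complex)
  + the strict `±`-decomposition at the odd prime `p` for `K = ℚ(θ)`, `θ² = d_K` + `E^{(d_K)} ≅ E'`
  over `ℚ`. (k7r-c4 g2 typed this at `p = 7`, `natCard_selmerAcBase_frame_eq_mul`; the three inputs
  are `p`-generic.)
* `finite_selmerAcBase_frame_iff_prime` — hence `Sel_𝔭(K, E[p^∞])` finite ⟺ both `ℚ`-side strict
  groups finite.
* `finite_strictSelmerPInfty_frame_of_GZK_prime` — under GZK both `ℚ`-side strict groups are finite at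
  an analytic-rank-one frame (`W' ∼ W`, so `r_an(W') = 1` too).
* **`ramifiedCMStrictTorsionAt_of_GZK_of_noPTorsion`** — (R-tors)@`p` at `W` from the named fact GZK
  and the two LOCAL inputs, displayed as hypotheses exactly in the shape of the seat's g0 reduction
  `ramifiedCMStrictTorsionAt_of_noPTorsion_of_finite_base`: (A𝔭) `W(K_𝔭)[p] = 0` and (Av) good
  reduction or `W(K_v)[p] = 0` at every finite `v ∤ p`, at every frame. For 𝒞₇ at `p = 7` both are
  kernel theorems (k7r-c3 g0 `SevenTorsion…`, k7r-c4 g0 `good_or_noSevenTorsion_of_classCSeven`),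
  which recovers `strictTorsionSeven_of_GZK` (an `example` at the end of the file checks this);
  at `p ∈ {11, 19, 43, 67, 163}` they are seat k7r-c4's programme (STATUS 2026-08-26T09:54:25Z) and
  will be consumed by name when landed.

No Euler system, no `Λ`-module structure theory, no elliptic unit is used. CONDITIONAL on the named
Literature fact `rank_eq_analyticRank_of_analyticRank_le_one` (hypothesis `hGZK`).

References: [DokchitserDokchitserAnnals2010] Lemma 4.14 (proof); [Castella2018] Def. 2.2 (arXiv:1704.06608
p. 5); [GreenbergLNM1716] §1 p. 61, §3 Lemmas 3.1–3.3, §4 Lemma 4.2; [Darmon2004] Thm. 3.22 (the named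
fact GZK); [Kolyvagin1990] Thm. A; [BurungaleKobayashiNakamuraOta2026] Prop. 3.7 (2) (arXiv:2608.06879;
the printed claim at ramified `p ≥ 5` that this makes unnecessary in analytic rank one — nothing of it
is used).
-/

noncomputable section

open scoped Classical

open WeierstrassCurve NumberField IsDedekindDomain Field
  Literature.NumberTheory.EllipticCurves
  Literature.NumberTheory.EllipticCurves.Rank1Residual
  Literature.NumberTheory.GaloisRepresentations
  Summit.BirchSwinnertonDyer.Rank1Residual
  Summit.BirchSwinnertonDyer.Rank1Residual.Additive
  Summit.BirchSwinnertonDyer.Rank1Residual.X11b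
  Summit.BirchSwinnertonDyer.Rank1Residual.X11b.AcSelmer

namespace Summit.BirchSwinnertonDyer.BirchSwinnertonDyer.Theorems.RamifiedSevenEllipticUnits

/-! ## §1 The unconditional count at a frame, every prime -/

/-- An O11 frame lives at a prime `p ≥ 5`, so `p` is odd. [folklore] -/
theorem odd_of_isFrame (W : WeierstrassCurve ℚ) [W.IsElliptic] (p : ℕ) [Fact p.Prime]
    {K : Type} [Field K] [NumberField K] {𝔭 : HeightOneSpectrum (𝓞 K)}
    {W' : WeierstrassCurve ℚ} {C : VariableChange ℚ} (hF : X12.O11.IsFrame W p K 𝔭 W' C) :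
    Odd p :=
  (Fact.out : p.Prime).odd_of_ne_two (by have := hF.2.2.1; omega)

/-- **(D♮)_p — the twist-descent count at an O11 frame, every prime, unconditional `Nat.card` form.**
For `W/ℚ` elliptic and a frame `(K, 𝔭, W', C)` of `(W, p)` (`X12.O11.IsFrame W p K 𝔭 W' C`):
`#Sel_𝔭(K, E[p^∞]) = #Sel_str(E/ℚ)[p^∞] · #Sel_str(E'/ℚ)[p^∞]` as natural-number cardinalities
(`0` for an infinite group). Castella bridge (the ramified `p ∣ d_K` has a unique prime above it in the
imaginary quadratic `K`), the strict `±`-decomposition at the odd prime `p` for `K = ℚ(θ)`, `θ² = d_K`,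
and the `ℚ`-isomorphism `E^{(d_K)} ≅ E'`. No finiteness hypothesis; `p = 7` is k7r-c4's
`natCard_selmerAcBase_frame_eq_mul`.
[cite: DokchitserDokchitserAnnals2010, Lemma 4.14 (proof)] [cite: Castella2018, Def. 2.2 (arXiv:1704.06608 p. 5)] -/
theorem natCard_selmerAcBase_frame_eq_mul_prime (W : WeierstrassCurve ℚ) [W.IsElliptic]
    (p : ℕ) [Fact p.Prime] (K : Type) [Field K] [NumberField K] (𝔭 : HeightOneSpectrum (𝓞 K))
    (W' : WeierstrassCurve ℚ) (C : VariableChange ℚ) (hF : X12.O11.IsFrame W p K 𝔭 W' C) :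
    Nat.card (selmerAcBase (W.baseChange K) p 𝔭 ∅) =
      Nat.card ↥(strictSelmerPInfty W p) * Nat.card ↥(strictSelmerPInfty W' p) := by
  have hK : IsImaginaryQuadratic K := hF.2.2.2.1
  have hdisc : NumberField.discr K = cmFieldDiscrOfJ W.j := hF.2.2.2.2.1
  have h𝔭 : ((p : ℕ) : 𝓞 K) ∈ 𝔭.asIdeal := hF.2.2.2.2.2.1
  have hW' : C • W.quadraticTwist ((cmFieldDiscrOfJ W.j : ℤ) : ℚ) = W' := hF.2.2.2.2.2.2
  have hram : (p : ℤ) ∣ NumberField.discr K := by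
    rw [hdisc]
    exact hF.2.1
  haveI : IsTotallyComplex K := hK.2
  haveI : (W.baseChange K).IsElliptic := by rw [baseChange]; infer_instance
  -- `𝔭` is the only prime of `K` above the ramified `p`
  have huniq : ∀ v : HeightOneSpectrum (𝓞 K), ((p : ℕ) : 𝓞 K) ∈ v.asIdeal → v = 𝔭 := fun v hv ↦
    eq_of_mem_of_dvd_discr_of_finrank_eq_two hK.1 Fact.out hram hv h𝔭
  -- `K = ℚ(θ)`, `θ² = d_K`
  obtain ⟨θ, hθ, hθsq⟩ := exists_sq_eq_discr_not_mem_range K hK.1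
  rw [hdisc] at hθsq
  rw [natCard_selmerAcBase_eq_natCard_iInf (W.baseChange K) p 𝔭 huniq,
    natCard_iInf_selmerLocalKerPrimaryTorsion_eq_mul W K hK.1 hθ hθsq p (odd_of_isFrame W p hF) h𝔭,
    natCard_strictSelmerPInfty_eq_of_variableChange p hW']

/-- **Finiteness transfer at a frame, every prime (both directions).** For a frame `(K, 𝔭, W', C)`
of `(W, p)`: `Sel_𝔭(K, E[p^∞])` is finite iff both `Sel_str(E/ℚ)[p^∞]` and `Sel_str(E'/ℚ)[p^∞]` are.
From (D♮)_p and `Nat.card ≠ 0 ⟺ finite` for groups. [cite: DokchitserDokchitserAnnals2010, Lemma 4.14 (proof)] -/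
theorem finite_selmerAcBase_frame_iff_prime (W : WeierstrassCurve ℚ) [W.IsElliptic]
    (p : ℕ) [Fact p.Prime] (K : Type) [Field K] [NumberField K] (𝔭 : HeightOneSpectrum (𝓞 K))
    (W' : WeierstrassCurve ℚ) (C : VariableChange ℚ) (hF : X12.O11.IsFrame W p K 𝔭 W' C) :
    Finite (selmerAcBase (W.baseChange K) p 𝔭 ∅) ↔
      Finite ↥(strictSelmerPInfty W p) ∧ Finite ↥(strictSelmerPInfty W' p) := by
  have h := natCard_selmerAcBase_frame_eq_mul_prime W p K 𝔭 W' C hF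
  constructor
  · intro hfin
    have hne : Nat.card (selmerAcBase (W.baseChange K) p 𝔭 ∅) ≠ 0 := Nat.card_pos.ne'
    rw [h] at hne
    exact ⟨Nat.finite_of_card_ne_zero (left_ne_zero_of_mul hne),
      Nat.finite_of_card_ne_zero (right_ne_zero_of_mul hne)⟩
  · rintro ⟨hW, hW'⟩
    refine Nat.finite_of_card_ne_zero ?_
    rw [h]
    exact mul_ne_zero Nat.card_pos.ne' Nat.card_pos.ne'

/-! ## §2 Under Gross–Zagier–Kolyvagin the base group is finite at every analytic-rank-one frame -/

/-- **At a frame both twins have finite strict `p^∞`-Selmer groups under GZK**, every prime: `W'` is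
isogenous to `W` (`isIsogenous_of_isFrame`), so `r_an(W') = r_an(W) = 1`, and
`finite_strictSelmerPInfty_of_GZK` applies to both. CONDITIONAL on the named fact (hypothesis `hGZK`).
[cite: Skinner2020, §2.2] [cite: Kolyvagin1990, Thm. A] -/
theorem finite_strictSelmerPInfty_frame_of_GZK_prime (hGZK : rank_eq_analyticRank_of_analyticRank_le_one)
    (W : WeierstrassCurve ℚ) [W.IsElliptic] [W.IsGloballyMinimal] (p : ℕ) [Fact p.Prime]
    {K : Type} [Field K] [NumberField K] {𝔭 : HeightOneSpectrum (𝓞 K)}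
    {W' : WeierstrassCurve ℚ} [W'.IsElliptic] [W'.IsGloballyMinimal] {C : VariableChange ℚ}
    (hF : X12.O11.IsFrame W p K 𝔭 W' C) (h1 : W.analyticRank = 1) :
    Finite ↥(Additive.strictSelmerPInfty W p) ∧ Finite ↥(Additive.strictSelmerPInfty W' p) := by
  have h1' : W'.analyticRank = 1 := by
    rw [← analyticRank_eq_of_isIsogenous' (isIsogenous_of_isFrame hF), h1]
  exact ⟨finite_strictSelmerPInfty_of_GZK hGZK W p h1, finite_strictSelmerPInfty_of_GZK hGZK W' p h1'⟩

/-- **(F)_p under GZK**: at every analytic-rank-one O11 frame of `(W, p)`, Castella's strict Selmer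
group `Sel_𝔭(K, W[p^∞])` over the CM field is finite. CONDITIONAL on the named fact (hypothesis
`hGZK`). [cite: Kolyvagin1990, Thm. A] [cite: DokchitserDokchitserAnnals2010, Lemma 4.14 (proof)] -/
theorem finite_selmerAcBase_frame_of_GZK_prime (hGZK : rank_eq_analyticRank_of_analyticRank_le_one)
    (W : WeierstrassCurve ℚ) [W.IsElliptic] [W.IsGloballyMinimal] (p : ℕ) [Fact p.Prime]
    {K : Type} [Field K] [NumberField K] {𝔭 : HeightOneSpectrum (𝓞 K)}
    {W' : WeierstrassCurve ℚ} [W'.IsElliptic] [W'.IsGloballyMinimal] {C : VariableChange ℚ}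
    (hF : X12.O11.IsFrame W p K 𝔭 W' C) (h1 : W.analyticRank = 1) :
    Finite (selmerAcBase (W.baseChange K) p 𝔭 ∅) :=
  (finite_selmerAcBase_frame_iff_prime W p K 𝔭 W' C hF).mpr
    (finite_strictSelmerPInfty_frame_of_GZK_prime hGZK W p hF h1)

/-! ## §3 (R-tors) at every CM-ramified prime from GZK and the two local inputs -/

/-- **(R-tors)@`p` at `W` ⟸ GZK ∧ (A𝔭) ∧ (Av), every prime `p`.** For `W/ℚ` globally minimal and a
prime `p`: if at every O11 frame `(K, 𝔭, W', C)` of `(W, p)` (A𝔭) `W(K_𝔭)[p] = 0` and (Av) at every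
finite `v ∤ p` of `K` the base change `W_K` has good reduction at `v` or `W(K_v)[p] = 0`, then, granted
the named fact GZK, `X12.O11.RamifiedCMStrictTorsionAt W p` holds: the strict anticyclotomic Selmer
dual at `𝔭` is torsion with `f(0) ≠ 0` and finite `X[T]` at every analytic-rank-one frame. Proof =
the seat's g0 reduction `ramifiedCMStrictTorsionAt_of_noPTorsion_of_finite_base` (exact control +
Greenberg's criterion on the dual pair) fed with (F)_p (`finite_selmerAcBase_frame_of_GZK_prime`).
CONDITIONAL on GZK (hypothesis `hGZK`); the local inputs are displayed hypotheses (kernel theorems for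
𝒞₇ at `7`; seat k7r-c4's programme at `p ∈ {11, 19, 43, 67, 163}`).
[cite: GreenbergLNM1716, §1 p. 61, §3 Lemmas 3.1–3.3 and §4 Lemma 4.2] [cite: Kolyvagin1990, Thm. A] -/
theorem ramifiedCMStrictTorsionAt_of_GZK_of_noPTorsion
    (hGZK : rank_eq_analyticRank_of_analyticRank_le_one)
    (W : WeierstrassCurve ℚ) [W.IsElliptic] [W.IsGloballyMinimal] (p : ℕ) [Fact p.Prime]
    (h𝔭 : ∀ (K : Type) [Field K] [NumberField K] (𝔭 : HeightOneSpectrum (𝓞 K))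
      (W' : WeierstrassCurve ℚ) [W'.IsElliptic] [W'.IsGloballyMinimal] (C : VariableChange ℚ),
      X12.O11.IsFrame W p K 𝔭 W' C →
      ∀ R : ((W.baseChange K).baseChange (𝔭.adicCompletion K)).toAffine.Point, p • R = 0 → R = 0)
    (hv : ∀ (K : Type) [Field K] [NumberField K] (𝔭 : HeightOneSpectrum (𝓞 K))
      (W' : WeierstrassCurve ℚ) [W'.IsElliptic] [W'.IsGloballyMinimal] (C : VariableChange ℚ),
      X12.O11.IsFrame W p K 𝔭 W' C →
      ∀ v : HeightOneSpectrum (𝓞 K), ((p : ℕ) : 𝓞 K) ∉ v.asIdeal →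
        (W.baseChange K).HasGoodReductionAt v ∨
          ∀ R : ((W.baseChange K).baseChange (v.adicCompletion K)).toAffine.Point,
            p • R = 0 → R = 0) :
    X12.O11.RamifiedCMStrictTorsionAt W p :=
  ramifiedCMStrictTorsionAt_of_noPTorsion_of_finite_base W p h𝔭 hv
    fun _ _ _ _ _ _ _ _ hF h1 ↦ finite_selmerAcBase_frame_of_GZK_prime hGZK W p hF h1

/- **Consistency check at `p = 7`** (an `example`, not a declaration: the statement is literally
that of the landed `strictTorsionSeven_of_GZK`): feeding the two 𝒞₇ local theorems (k7r-c3 g0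
`SevenTorsion.seven_nsmul_adicCompletion_eq_zero_of_isFrame`, k7r-c4 g0
`good_or_noSevenTorsion_of_classCSeven`) to `ramifiedCMStrictTorsionAt_of_GZK_of_noPTorsion` recovers
the route item under GZK. -/
example (hGZK : rank_eq_analyticRank_of_analyticRank_le_one) :
    Summit.BirchSwinnertonDyer.BirchSwinnertonDyer.Theses.RamifiedSevenEllipticUnits.StrictTorsionSeven :=
  fun W _ _ _ hC ↦
    ramifiedCMStrictTorsionAt_of_GZK_of_noPTorsion hGZK W 7
      (fun _ _ _ 𝔭 W' _ _ C hF ↦ SevenTorsion.seven_nsmul_adicCompletion_eq_zero_of_isFrame W hC 𝔭 W' C hF)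
      (fun _ _ _ _ _ _ _ _ hF ↦ good_or_noSevenTorsion_of_classCSeven W hC hF)

end Summit.BirchSwinnertonDyer.BirchSwinnertonDyer.Theorems.RamifiedSevenEllipticUnits

end
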